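import Summits.BirchSwinnertonDyer.Rank1Residual.ManinAdditive.ThetaBrandtDegreeLaws
import HarnessLib
import HarnessLib.Audit.Tags

/-!
# The θ₄-BRANDT degree law at `9 ∥ N` — the `p = 3` TWIN of the θ-Brandt law E-desc-117: rows E-desc-123 (III/III*)
# and E-desc-124 (Iₙ*) typed
# (cell `bsd-f2-manin`, desc g18, MEMO-desc §39; nothing asserted)

TYPER NOTE (typer g18, T-desc-32).  SOURCE = HOME/desc/g18/Sketch-desc-g18b.lean sha16 8b3a4d5945ef2654 (467 l.; desc: farm rc 0 · 0 err · 0 warn ·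
0 sorry, 44.6 s incl. the `decide +kernel` certificates), landed VERBATIM in TWO modules because of the gate's 400-line cap on theorem-bearing
statement files: THIS file = the sketch's module docstring + §1–§3 (the maximal order of `(−1,−3)_ℚ`, `θ₄`, `ℤ[i]`, the action on `ℙ¹(𝔽_p)`, the
θ₄-Brandt module at prime level, the E-side exponents `IsTypeThreeStarAtThreeTame` / `IsTwoEisensteinDegenerateAtNine`, row **E-desc-123**
`ThetaFourBrandtDegreeLawAtNinePrime` as an `@[conjecture]` node, and the PROVED prime-level reading `isTwoEisensteinDegenerateAtNine_iff_of_conductor_eq`);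
the sibling `ThetaFourBrandtDegreeLawAtNineCert.lean` = §4 (structure lemmas, kernel certificates at `p = 11`: 99a1/99c1 and `p = 17`: 153a1/153d1)
+ §5 (the `θ₄²`-module, row **E-desc-124** `ThetaFourSqBrandtDegreeLawAtNinePrime`, certificates 171d1 / 99b1).  Nothing else changed (no renames;
desc's computable helper predicates `def … : Prop` with binders are schemas, not named facts — same pattern as `IsThetaEquivariant` / `IsPrimitive`
in the landed `p = 2` file `ThetaBrandtDegreeLaws.lean`).  HONEST FRAMING.  LENS: desc (quaternionic descent / Brandt modules: the `p = 3` twin of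
the θ-Brandt degree law E-desc-117).  STATUS: LAW (CONJECTURAL identity, 454/454 in range; desc: «NOT in print» for the character-`θ₄` module at a
supercuspidal prime; beyond-print theorem: NO); it reads `deg φ`, not the Manin constant — nothing about `c` is decided.  BC5 WITNESS:
HOME/desc/g18/b3/CENSUS-123.md + CENSUS-123.txt sha16 48f63f319e261942 (454/454 optimal III/III* curves `9 ∥ N ≤ 9999`, `(N/9, 6) = 1`; E-desc-124:
971/971 `Iₙ*`), engine brandt3.py (JL dimension check 41/41 levels).  REFUTER VERDICTS: R-desc-30 (ref1) PENDING at filing; ref2 PENDING.  CHEAPEST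
FALSIFIER (desc): an optimal III/III* curve at prime level `9p`, `p > 1019`, `p ≡ 3 (mod 4)`, `E(ℚ)[2] ≠ 0`, `2 ∣ c_p`.  PARTITION currency: 0;
bears_on: stmt-BirchSwinnertonDyer-22968 (C3 core population III/III* at `9 ∥ N`).  BSD is not proved by this; Manin's conjecture is not proved; C2/C3 OPEN.

SKETCH (planner bsd-f2-manin-desc g18).  Sibling of `ThetaBrandtDegreeLaws.lean` (the `p = 2` file, whose `toPoint` and
doubled-coordinate conventions it reuses).  Engine + census: `HOME/desc/g18/b3/` (`brandt3.py`, `run3.py`,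
`CENSUS-123.md`, `SHA16SUMS.desc.g18`).

THE OBJECT (§1–§2, computable at PRIME level `M = p ≥ 5`).  `B = B_{3,∞} = (−1,−3)_ℚ` (`i² = −1`, `j² = −3`, `k = ij`),
`O = ℤ⟨1, i, ζ, iζ⟩` with `ζ = (1+j)/2` its maximal order (`O = ℤ[ζ] ⊕ ℤ[ζ]·i`, reduced discriminant `3`), `O^× =
{±ζ^a, ±ζ^a i}` of order `12` (`O^×/±1 ≅ S₃`), `𝔓 = jO` the two-sided prime over `3`, `O/𝔓 = 𝔽₉ = 𝔽₃[i]`.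
`θ₄ : (O/𝔓)^× → μ₄ ⊂ ℤ[i]^×`, `θ₄(x) = (x mod 𝔓)²` read in `ℤ[i]` via `i ↦ i`: the character of ORDER 4 of
`𝔽₉^×/𝔽₃^× ≅ ℤ/4`; `θ₄ ≡ 1` on `⟨ζ⟩ ≅ ℤ/6` and `θ₄ = −1` on the six units `±ζ^a i` of order 4.
DOUBLED COORDINATES: `q = (A,B,C,D) ∈ ℤ⁴` with `A ≡ C`, `B ≡ D (mod 2)` stands for `(A + Bi + Cj + Dk)/2 ∈ O`;
`4·Nrd(q) = A² + B² + 3C² + 3D²`; `q mod 𝔓 = −A − B·i ∈ 𝔽₃[i]`.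
For a prime `p ≥ 5` let `P = ℙ¹(𝔽_p) = Fin (p+1)` with the left action of `O` through `O ⊗ 𝔽_p ≅ M₂(𝔽_p)`,
`i ↦ I = (0 −1; 1 0)`, `j ↦ J = (a b; b −a)` with `a² + b² ≡ −3 (mod p)`, `k ↦ K = IJ = (−b a; a b)`.
The θ₄-BRANDT MODULE of level `9p` is
  `𝓜_θ₄(p) = {g : P → ℤ[i] : g(u·x) = θ₄(u)⁻¹ g(x) for all u ∈ O^×}`
(support = the `S₃`-orbits whose stabiliser meets no unit of order 4, i.e. stabiliser `⊂ ⟨ζ⟩/±1 ≅ C₃`, weight `w ∈ {1, 3}`),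
Hecke operators `(T_ℓ f)(x) = (1/12) Σ_{γ ∈ O, Nrd γ = ℓ} θ₄(γ) f(γ·x)` (`ℓ ∤ 3p` prime; `12(ℓ+1)` terms), GROSS HEIGHT
`⟨m, m⟩ = Σ_{orbits o} w_o · Nm(m_o)`.
JACQUET–LANGLANDS DICTIONARY (CHECKED, `brandt3.py`, all 41 odd `M ≤ 127` prime to 3, prime AND composite, incl. `25, 49,
121, 125`): with `θ₄² = η₃ ∘ Nrd` (the quadratic character) and `n_χ(M)` the new part of `dim 𝓜_χ(M)` under
`dim 𝓜_χ(M) = Σ_{d ∣ M} σ₀(M/d) n_χ(d)` (one Eisenstein line `η₃∘Nrd` removed from `𝓜_{θ₄²}`):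
  `n_{θ₄}(M) + n_{θ₄²}(M) + dim S₂^{new}(Γ₀(M)) = dim S₂^{new}(Γ₀(9M))`     (41/41 levels),
i.e. `𝓜_θ₄(M) ⊗ ℂ ≅ ⊕_{d ∣ M} S₂^{new}(Γ₀(9d))^{SC}` = the newforms whose local type at 3 is the UNIQUE depth-zero
supercuspidal representation of conductor 9 with trivial central character `σ₀ = Ind_{ℚ₉/ℚ₃}(χ₀)`, `χ₀|_{ℤ₉^×} = θ₄`,
`χ₀(3) = −1` (Kodaira III / III* at 3 = `e = 4`; `σ₀ ≅ σ₀ ⊗ χ₋₃ ≅ σ₀ ⊗ μ₂`, so `E` and its `−3`-twist BOTH live here),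
`𝓜_{θ₄²}` = the `η₃`-twisted Steinberg types (Kodaira `Iₙ*`, `n ≥ 1`), and the principal-series type (`I₀*`) is invisible.
For every one of the 454 `X₀(N)`-optimal curves `E` with `N = 9M`, `5 ≤ M ≤ 1111` prime to 6 (`N ≤ 9999`), of Kodaira
type III or III* at 3, the `f_E`-eigenline of `𝓜_θ₄(M)` (cut out by `T_ℓ = a_ℓ(E)` for the seven
smallest primes `ℓ ∤ 3M`) is a free `ℤ[i]`-module of RANK ONE (454/454); `m_E` = a primitive generator,
`ξ_θ₄(E) := ⟨m_E, m_E⟩ ∈ ℕ` (unit-independent).  The `Iₙ*` curves (971 of 972; one rank-5 system at `N = 6435` not separated by seven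
`T_ℓ`) have their rank-one line in `𝓜_{θ₄²}`; the 341 `I₀*` curves have none (not searched: PS type).

THE LAW (E-desc-123, `ThetaFourBrandtDegreeLawAtNinePrime` below at prime `M = p`; `ThetaFourBrandtDegreeLawAtNine` is the
all-`M` reading, definition request D-desc-28 for the general-level module):  for the `X₀(N)`-OPTIMAL curve `E`, `N = 9M`,
`(M, 6) = 1`, Kodaira III or III* at 3:
  `2^{t₂(E)} · deg φ_E = 4 · 3^{b(E)} · ξ_θ₄(E)`,   `b(E) = [E is III* at 3] = [v₃(Δ_E) = 9]`,
  `t₂(E) = 1` iff `E` is 2-EISENSTEIN-DEGENERATE AT NINE (`IsTwoEisensteinDegenerateAtNine`): `E(ℚ)[2] ≠ 0`, `2 ∤ c_q(E)`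
  for every prime `q ∣ M`, and `q ≡ 3 (mod 4)` for every `q ∥ M`; else `t₂(E) = 0`.
CENSUS (BC5 witness, `CENSUS-123.md`, row file `CENSUS-123.txt` sha16 48f63f319e261942): ALL 454 optimal III/III* curves
with `N = 9M ≤ 9999`, `(M,6) = 1` (68 of them at the 30 prime levels `p ≤ 1019`): `deg φ / ξ_θ₄ = 4` (III, `t₂ = 0`: 236),
`12` (III*, `t₂ = 0`: 196), `2` (III, `t₂ = 1`: 11), `6` (III*, `t₂ = 1`: 11); 0 / 454 violations; the 22 `t₂ = 1` curves are
the eleven twin pairs `{E, E ⊗ χ₋₃}` `99a1/c1, 603a1/b1, 747b1/a1, 1251b1/a1, 1611a1/b1, 1899a1/b1, 2763a1/b1, 3987a1/b1,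
5139b1/a1, 6651a1/b1, 9171b1/a1` — all at PRIME level `p ≡ 3 (mod 4)` (`p = 11, 67, 83, 139, 179, 211, 307, 443, 571,
739, 1019`); every composite-level 2-torsion curve of the census (132) has an even `c_q` or a `q ∥ M` with `q ≡ 1 (mod 4)`,
and so do the 4 prime-level ones at `p ≡ 1 (mod 4)`.  So `ord_ℓ deg φ = ord_ℓ ξ_θ₄(E)` for every prime `ℓ ≥ 5`, `ord₃ deg φ = ord₃ ξ_θ₄ + b(E)`,
`ord₂ deg φ = ord₂ ξ_θ₄ + 2 − t₂(E)` — the ADDITIVE Ribet–Takahashi / Pollack–Weston formula at the supercuspidal prime 3,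
with the two explicit local corrections `b(E)` (the `χ₋₃`-twist: `deg φ(E ⊗ χ₋₃) = 3 · deg φ(E)` on every twin pair,
III ↦ III*, on all 207 twin pairs of OPTIMAL curves, while `m_{E⊗χ₋₃} = conj ∘ m_E` has the SAME height; in 13 further
class pairs — every one with a rational 3-isogeny, cf. the cell's E-imc-3b — the twist of the optimal (type III) curve is the
NON-optimal member of the partner class, and at the 7 CM levels `N = 9q²` the class is its own twist) and `2 − t₂(E)` (the unit index
`[O_𝔓^× : ℤ₃^×(1+𝔓)] = #𝔽₉^×/#𝔽₃^× = 4`, halved exactly in the 2-Eisenstein-degenerate case — the twin of the `p = 2`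
exponent `1 − t(E)` of E-desc-117 with the roles `(ℓ = 3, λ = 1−ω, 𝔽₄^×/𝔽₂^× ≅ ℤ/3)` ↦ `(ℓ = 2, λ = 1+i, 𝔽₉^×/𝔽₃^× ≅ ℤ/4)`).
THE SIGN (no law claimed): the antilinear involution `ι₃ m = conj ∘ m ∘ j` (`j` = the uniformiser of `𝔓`, `θ₄ ∘ Ad(j) = θ₄³`)
preserves every eigenline, `ι₃ m_E = ζ_E m_E`, `s₃(E) := ζ_E² ∈ {±1}` is unit-free and twin-invariant (207/207 pairs) but
reads NO tested invariant (III/III*, `p mod 12`, rank, `w_p`, `a₂`: balanced tables in `CENSUS-123.md` §3) — as it must: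
`λ₃ = 1 + i` has residue field `𝔽₂`, every unit is `≡ 1 (mod λ₃)`, and `c₃(E) = 2` is CONSTANT on III/III*; the `p = 2` sign
law E-desc-119R has no `p = 3` twin (and the Atkin–Lehner sign at 9 is `+1` on the whole SC sector: cell imc ENGINE 13,
863/863 newform orbits `9 ∥ N ≤ 1296`).

What is NOT in print (searches below): a Gross-height / modular-degree identity for the NON-Eichler (character-`θ₄`) Brandt module
of `B_{3,∞}` at an additive supercuspidal prime, with its 2- and 3-corrections.  In print and used only as DICTIONARY:
Jacquet–Langlands with types (the `K_𝔓(θ₄)`-isotypic vectors of `σ₀^{JL}`), Gross 1987 heights of Brandt vectors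
(Eichler orders, `p ∥ N`), Ribet–Takahashi 1997 / Takahashi 2001 / Pollack–Weston 2011 Thm. 6.8 (`ord_p δ = ord_p ξ + Σ t(q)`,
square-free `N`), Böcherer–Schulze-Pillot (Brandt modules with character, theta series side).
Presearch (corpus fts+vec AND galaxy, 2026-08-29): no hits for "Brandt module" ∧ ("supercuspidal" ∨ "character of order 4")
∧ "modular degree" in corpus(fts+vec) and galaxy (`lit search --hybrid`, `lit vsearch`, `lit galaxy search
"Brandt module|modular degree" --star all`); nearest [corpus: PollackWeston2011 Thm 6.8] (square-free), [graph:
doi:10.1215/S0012-7094-87-05409-5 Gross 1987].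
-/

namespace Summit.BirchSwinnertonDyer.Rank1Residual.ManinAdditive.ThetaFourBrandt

open scoped MatrixGroups ModularForm
open CongruenceSubgroup WeierstrassCurve Literature.NumberTheory.EllipticCurves.ModularForms
open Summit.BirchSwinnertonDyer.Rank1Residual.ManinAdditive.ConwayCut (HasRationalTwoTorsion)
open Summit.BirchSwinnertonDyer.Rank1Residual.ManinAdditive.HurwitzBrandt (DQuat toPoint)
open Summit.BirchSwinnertonDyer.Rank1Residual.ManinAdditive.ThetaBrandt (tamagawaAt)

/-! ### §1. The maximal order of `(−1,−3)_ℚ` in doubled coordinates, its 12 units, `θ₄` -/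

/-- parity condition of `O = ℤ⟨1, i, (1+j)/2, (i+k)/2⟩` in doubled coordinates: `A ≡ C`, `B ≡ D (mod 2)`. [folklore] -/
abbrev DicParity (q : DQuat) : Prop :=
  q.1 % 2 = q.2.2.1 % 2 ∧ q.2.1 % 2 = q.2.2.2 % 2

/-- four times the reduced norm in `(−1,−3)`: `A² + B² + 3C² + 3D²`. [folklore] -/
def dnorm3 (q : DQuat) : ℤ := q.1 ^ 2 + q.2.1 ^ 2 + 3 * q.2.2.1 ^ 2 + 3 * q.2.2.2 ^ 2

/-- ALL elements of `O` of reduced norm `r`, in doubled coordinates (`12·(r+1)` of them for a prime `r ≠ 3`). [folklore] -/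
def dicyclicOfNorm (r : ℕ) : List DQuat :=
  let m : ℕ := Nat.sqrt (4 * r)
  let cs : List ℤ := (List.range (2 * m + 1)).map (fun t => (t : ℤ) - m)
  (cs.flatMap fun a => cs.flatMap fun b => cs.flatMap fun c => cs.map fun d => ((a, b, c, d) : DQuat)).filter
    (fun q => decide (DicParity q) && dnorm3 q == 4 * (r : ℤ))

/-- the 12 units `±ζ^a, ±ζ^a·i` (`ζ = (1+j)/2`); `O^×/±1 ≅ S₃`. [folklore] -/
def dicyclicUnits : List DQuat := dicyclicOfNorm 1

/-- `θ̃₄(q) ∈ {0,1,2,3}`: `θ₄(q) = i^{θ̃₄(q)}` where `θ₄(q) = (q mod 𝔓)²`, `q mod 𝔓 = x + y·i ∈ 𝔽₃[i]` with `x = −A`, `y = −B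
(mod 3)`; `(x + yi)² = (x² − y²) + 2xy·i ∈ {1, i, −1, −i}` for `q ∉ 𝔓` (junk `0` on `𝔓`, never used: units and elements of
norm prime to 3 are prime to `𝔓`). [folklore] -/
def theta4Exp (q : DQuat) : ℕ :=
  let x : ℤ := (-q.1) % 3
  let y : ℤ := (-q.2.1) % 3
  let re : ℤ := (x * x - y * y) % 3
  let im : ℤ := (2 * x * y) % 3
  if im = 0 then (if re = 1 then 0 else if re = 2 then 2 else 0) else (if im = 1 then 1 else 3)

/-! ### §2. `ℤ[i]`, the action on `ℙ¹(𝔽_p)`, the θ₄-Brandt module at prime level -/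

/-- `ℤ[i]` as pairs `(a, b) ↔ a + b·i`; plain functions, no instances (typer lint). [folklore] -/
abbrev ZI : Type := ℤ × ℤ

/-- addition in `ℤ[i]`. [folklore] -/
def ZI.add (z w : ZI) : ZI := (z.1 + w.1, z.2 + w.2)

/-- multiplication in `ℤ[i]`. [folklore] -/
def ZI.mul (z w : ZI) : ZI := (z.1 * w.1 - z.2 * w.2, z.1 * w.2 + z.2 * w.1)

/-- complex conjugation on `ℤ[i]`. [folklore] -/
def ZI.conj (z : ZI) : ZI := (z.1, -z.2)

/-- the norm `Nm(a + bi) = a² + b²`. [folklore] -/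
def ZI.norm (z : ZI) : ℤ := z.1 ^ 2 + z.2 ^ 2

/-- multiplication by `i^n` (`i·(a + bi) = −b + ai`). [folklore] -/
def ZI.iPowMul : ℕ → ZI → ZI
  | 0, z => z
  | n + 1, z => ZI.iPowMul n (-z.2, z.1)

/-- a pair `(a, b)` of residues with `a² + b² + 3 ≡ 0 (mod p)` (first in lexicographic order; exists for every prime `p ≥ 5`;
junk `(0,0)` otherwise). [folklore] -/
def negThreeAsSumOfTwoSquares (p : ℕ) : ℕ × ℕ :=
  (((List.range p).flatMap fun a => (List.range p).map fun b => (a, b)).find?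
    (fun ab => (ab.1 ^ 2 + ab.2 ^ 2 + 3) % p == 0)).getD (0, 0)

/-- the action of the doubled element `q = (A,B,C,D)` of `O` on `x ∈ ℙ¹(𝔽_p)` through `2q ↦ A·1 + B·I + C·J + D·K`,
`I = (0 −1; 1 0)`, `J = (a b; b −a)`, `K = IJ = (−b a; a b)` (`a² + b² ≡ −3`), i.e.
`2M = (A + Ca − Db, −B + Cb + Da; B + Cb + Da, A − Ca + Db)`, `det(2M) ≡ A² + B² + 3C² + 3D² = 4·Nrd`
(invertible mod `p` for `p ∤ 6·Nrd q`; the scalar `2` is immaterial on `ℙ¹`); arithmetic in `ℕ` after reducing mod `p`,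
points via the `p = 2` file's `toPoint` (`j < p ↦ (j : 1)`, `p ↦ (1 : 0)`). [folklore] -/
def act3With (p a b : ℕ) (q : DQuat) (x : Fin (p + 1)) : Fin (p + 1) :=
  let A : ℕ := (q.1 % (p : ℤ)).toNat
  let B : ℕ := (q.2.1 % (p : ℤ)).toNat
  let C : ℕ := (q.2.2.1 % (p : ℤ)).toNat
  let D : ℕ := (q.2.2.2 % (p : ℤ)).toNat
  let na : ℕ := p - a % p
  let nb : ℕ := p - b % p
  let nB : ℕ := p - B % p
  let m11 : ℕ := A + C * a + D * nb
  let m12 : ℕ := nB + C * b + D * a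
  let m21 : ℕ := B + C * b + D * a
  let m22 : ℕ := A + C * na + D * b
  let v1 : ℕ := if (x : ℕ) < p then (x : ℕ) else 1
  let v2 : ℕ := if (x : ℕ) < p then 1 else 0
  toPoint p (m11 * v1 + m12 * v2) (m21 * v1 + m22 * v2)

/-- the action with the file's fixed embedding `negThreeAsSumOfTwoSquares p`. [folklore] -/
def act3 (p : ℕ) (q : DQuat) (x : Fin (p + 1)) : Fin (p + 1) :=
  act3With p (negThreeAsSumOfTwoSquares p).1 (negThreeAsSumOfTwoSquares p).2 q x

/-- `w(x)`: the order of the stabiliser of `x ∈ ℙ¹(𝔽_p)` in `S₃ = O^×/±1` (half the number of the 12 units fixing `x`);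
`w(x) ∈ {1, 3}` on the support of `𝓜_θ₄(p)`, `w(x) = 2` or `6` off it (a unit of order 4 in the stabiliser). [folklore] -/
def stabWeight3 (p : ℕ) (x : Fin (p + 1)) : ℕ :=
  (dicyclicUnits.filter fun u => decide (act3 p u x = x)).length / 2

/-- θ₄-EQUIVARIANCE of `g : ℙ¹(𝔽_p) → ℤ[i]`: `i^{θ̃₄(u)} · g(u·x) = g(x)` for all 12 units (so `g` vanishes where a unit of
order 4 stabilises).  `𝓜_θ₄(p)` = the θ₄-equivariant functions. [folklore] -/
def IsThetaFourEquivariant (p : ℕ) (g : Fin (p + 1) → ZI) : Prop :=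
  ∀ u ∈ dicyclicUnits, ∀ x : Fin (p + 1), ZI.iPowMul (theta4Exp u) (g (act3 p u x)) = g x

/-- PRIMITIVITY of `g` as a `ℤ[i]`-vector: every common divisor of the values is a unit. [folklore] -/
def IsPrimitive3 (p : ℕ) (g : Fin (p + 1) → ZI) : Prop :=
  ∀ d : ZI, (∀ x : Fin (p + 1), ∃ c : ZI, g x = ZI.mul d c) → ZI.norm d = 1

/-- the WEIGHTED function `f = W g`, `f(x) = w(x)·g(x)` (the Hecke condition is imposed on `f`, primitivity and the height
are read on `g`, exactly as in the `p = 2` file). [folklore] -/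
def weightMul3 (p : ℕ) (g : Fin (p + 1) → ZI) (x : Fin (p + 1)) : ZI :=
  ((stabWeight3 p x : ℤ) * (g x).1, (stabWeight3 p x : ℤ) * (g x).2)

/-- `12 · T_ℓ` on point functions: `(T₁₂ f)(x) = Σ_{γ ∈ O, Nrd γ = ℓ} i^{θ̃₄(γ)} · f(γ·x)` (all `12(ℓ+1)` elements of reduced
norm `ℓ`, a prime `ℓ ∤ 3p` — `ℓ = 2` allowed; each left unit coset contributes 12 equal terms; preserves θ₄-equivariance).
[folklore] -/
def thetaFourHecke12 (p ℓ : ℕ) (f : Fin (p + 1) → ZI) (x : Fin (p + 1)) : ZI :=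
  ((dicyclicOfNorm ℓ).map fun γ => ZI.iPowMul (theta4Exp γ) (f (act3 p γ x))).foldr ZI.add (0, 0)

/-- `f = W g` is a HECKE EIGENFUNCTION with eigenvalues `a = (a_ℓ)_ℓ`: `T₁₂,ℓ f = 12 a_ℓ · f` for every prime `ℓ ∤ 3p`.
[folklore] -/
def IsThetaFourHeckeEigen (p : ℕ) (g : Fin (p + 1) → ZI) (a : ℕ → ℤ) : Prop :=
  ∀ ℓ : ℕ, ℓ.Prime → ℓ ≠ 3 → ℓ ≠ p → ∀ x : Fin (p + 1),
    thetaFourHecke12 p ℓ (weightMul3 p g) x = (12 * a ℓ * (weightMul3 p g x).1, 12 * a ℓ * (weightMul3 p g x).2)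

/-- SIX TIMES THE GROSS HEIGHT: `6 · ⟨m, m⟩ = Σ_{x ∈ ℙ¹(𝔽_p)} w(x)² · Nm g(x)` (an orbit `o` has `6 / w_o` points carrying unit
multiples of `m_o`). [folklore] -/
def thetaFourHeightSix (p : ℕ) (g : Fin (p + 1) → ZI) : ℤ :=
  ((List.finRange (p + 1)).map fun x => (stabWeight3 p x : ℤ) ^ 2 * ZI.norm (g x)).sum

/-- the antilinear ATKIN–LEHNER involution at 3 on `𝓜_θ₄(p)`: `(ι₃ g)(x) = conj (g (j · x))`, `j = (0,0,2,0)` the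
uniformiser of `𝔓` (`θ₄(j u j⁻¹) = θ₄(u)³`, so `ι₃` preserves θ₄-equivariance; `ι₃² = id`). [folklore] -/
def thetaFourIota (p : ℕ) (g : Fin (p + 1) → ZI) (x : Fin (p + 1)) : ZI :=
  ZI.conj (g (act3 p ((0, 0, 2, 0) : DQuat) x))

/-! ### §3. The E-side exponents and row E-desc-123 -/

/-- Kodaira type III* at 3 on the tame cell `v₃(N) = 2` for a globally minimal `W`: `v₃(Δ) = 9` with potentially GOOD
reduction (`c₄ = 0` or `3·v₃(c₄) ≥ 9`, excluding `I₃*`); type III there is `v₃(Δ) = 3`. [folklore] -/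
def IsTypeThreeStarAtThreeTame (W : WeierstrassCurve ℚ) : Prop :=
  padicValNat 3 (W.conductorNorm ℤ) = 2 ∧ padicValRat 3 W.Δ = 9 ∧ (W.c₄ = 0 ∨ 9 ≤ 3 * padicValRat 3 W.c₄)

/-- **2-Eisenstein degeneracy at `9 ∥ N`** (desc g18 criterion `t₂(E) = 1`, the twin of `IsThreeEisensteinDegenerateAtFour`):
`E(ℚ)[2] ≠ 0`; `2 ∤ c_q(E)` for every prime `q ∣ N`, `q ≠ 3`; and every prime `q ∥ N`, `q ≠ 3`, is `≡ 3 (mod 4)`. [folklore] -/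
def IsTwoEisensteinDegenerateAtNine (W : WeierstrassCurve ℚ) : Prop :=
  HasRationalTwoTorsion W ∧
    ∀ q : ℕ, q.Prime → q ≠ 3 → q ∣ W.conductorNorm ℤ →
      ¬ 2 ∣ tamagawaAt W q ∧ (¬ q ^ 2 ∣ W.conductorNorm ℤ → q % 4 = 3)

open scoped Classical in
/-- **Row E-desc-123 `ThetaFourBrandtDegreeLawAtNinePrime` (LAW, identity; cell bsd-f2-manin, desc g18, MEMO-desc §39;
nothing asserted).**  For an `X₀(N)`-optimal curve of conductor `N = 9p`, `p ≥ 5` prime, and a primitive θ₄-equivariant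
`g : ℙ¹(𝔽_p) → ℤ[i]` whose weighted function `W g` is a Hecke eigenfunction for `(a_ℓ(E))_{ℓ ∤ 3p}` (such `g` exist, uniquely
up to `μ₄`, exactly for Kodaira III / III* at 3):
`3 · 2^{t₂(E)} · deg φ = 2 · 3^{b(E)} · (6⟨m_E, m_E⟩)`, i.e. `2^{t₂} deg φ = 4 · 3^{b} · ⟨m_E, m_E⟩` — see the module
docstring for `t₂`, `b` and the 454/454 census (prime-level sub-census: 68/68 curves at the 30 primes `p ≤ 1019`).
Why it might fail: an optimal III/III* curve of prime level `9p` beyond `p = 1019` with `E(ℚ)[2] ≠ 0`, `p ≡ 3 (mod 4)` and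
`2 ∣ c_p` (no such curve in range: the clause `2 ∤ c_p` is then untested at prime level), or a second, accidental Eisenstein
congruence mod `(1+i)³`.
[cite: CremonaEcdata] [cite: PollackWeston2011, Thm. 6.8 (shape only: square-free N, Eichler order — the supercuspidal θ₄-module and its 2- and 3-corrections are the cell's row E-desc-123, NOT in print)] [cite: Gross1987Heights, §3 (heights of Brandt vectors, Eichler orders; dictionary only)] -/
@[conjecture]
def ThetaFourBrandtDegreeLawAtNinePrime : Prop :=
  ∀ (p : ℕ), p.Prime → 5 ≤ p →
  ∀ (W : WeierstrassCurve ℚ) [W.IsElliptic] [W.IsGloballyMinimal] [NeZero (W.conductorNorm ℤ)]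
    (D : ModularParametrizationData W (W.conductorNorm ℤ)),
    W.conductorNorm ℤ = 9 * p →
    (∀ z ∈ D.L.lattice, ∃ w ∈ periodLattice D.f, z = D.c * w) →
    (∀ (W' : WeierstrassCurve ℚ) [W'.IsElliptic]
        (D' : ModularParametrizationData W' (W.conductorNorm ℤ)),
        D'.f = D.f → D.modularDegree ≤ D'.modularDegree) →
  ∀ g : Fin (p + 1) → ZI,
    IsThetaFourEquivariant p g → IsPrimitive3 p g → IsThetaFourHeckeEigen p g (fun n => W.LFunction n) →
    3 * (2 : ℤ) ^ (if IsTwoEisensteinDegenerateAtNine W then 1 else 0) * (D.modularDegree : ℤ) =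
      2 * 3 ^ (if IsTypeThreeStarAtThreeTame W then 1 else 0) * thetaFourHeightSix p g

/-- at prime level `N = 9p` the degeneracy criterion reads `E(ℚ)[2] ≠ 0 ∧ 2 ∤ c_p ∧ p ≡ 3 (mod 4)` (pure logic from the
definition; the only primes dividing `9p` other than `3` being `p`, and `p ∥ 9p`). -/
theorem isTwoEisensteinDegenerateAtNine_iff_of_conductor_eq {p : ℕ} (hp : p.Prime) (h5 : 5 ≤ p)
    (W : WeierstrassCurve ℚ) (hN : W.conductorNorm ℤ = 9 * p) :
    IsTwoEisensteinDegenerateAtNine W ↔ (HasRationalTwoTorsion W ∧ ¬ 2 ∣ tamagawaAt W p ∧ p % 4 = 3) := by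
  have hp3 : p ≠ 3 := by omega
  have hp2 : ¬ p ^ 2 ∣ 9 * p := by
    intro h
    have h9 : p ∣ 9 := by
      have : p * p ∣ 9 * p := by simpa [pow_two] using h
      exact (Nat.dvd_of_mul_dvd_mul_right hp.pos (by simpa [mul_comm] using this))
    have : p ≤ 9 := Nat.le_of_dvd (by norm_num) h9
    interval_cases p <;> simp_all (config := {decide := true})
  constructor
  · rintro ⟨hT, hall⟩
    have hq := hall p hp hp3 (by rw [hN]; exact Dvd.intro_left 9 rfl)
    exact ⟨hT, hq.1, hq.2 (by rw [hN]; exact hp2)⟩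
  · rintro ⟨hT, hc, hmod⟩
    refine ⟨hT, fun q hq hq3 hqN => ?_⟩
    rw [hN] at hqN
    have hqp : q = p := by
      rcases (Nat.Prime.dvd_mul hq).1 hqN with h9 | hqp
      · exfalso
        have : q ∣ 3 ^ 2 := by simpa using h9
        have := (Nat.prime_dvd_prime_iff_eq hq Nat.prime_three).1 (hq.dvd_of_dvd_pow this)
        exact hq3 this
      · exact (Nat.prime_dvd_prime_iff_eq hq hp).1 hqp
    subst hqp
    exact ⟨hc, fun _ => hmod⟩

end Summit.BirchSwinnertonDyer.Rank1Residual.ManinAdditive.ThetaFourBrandt
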